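/-
Copyright (c) 2026 the pub-hodgecm-mathlib formalisation cell (harness21).  Prover seat hodgecm-mathlib-F0P2-p09 (g3) on chair-VALVE loan to section S6 of the R90-TF
programme (S6 dealer R90-C14-plan (g2) CARD FIN-2 «J4a-ϖ» 2026-09-05T03:19:38Z; spec K2Liu-p05 (g9) `FIN-CENSUS.md` c477b047 §(G1)); crux H413 (`stmt-HodgeConjecture-24833`).
THEOREMS ONLY (no `def`, no `instance`, no notation, no named-fact hypothesis, no `sorry`).
-/
import Summits.HodgeConjecture.HodgeConjecture.Theorems.R90S6DiagonalFixedBoundedPi       -- ★ FIN-2 FILE A «J4a-ϖ»: `diagFixedPi_finite_setOf_latticeGraphIso_diagonal_eq`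
import Summits.HodgeConjecture.HodgeConjecture.Theorems.R90S6FlickerLiteralFrames         -- ★ FRAMES: `flickerFrame_weyl_mem_fixedBy` (+ ★ REGIMES `flickerLiteral_normOne_letters`, `flickerLiteral_norm_one_letters`)
import Literature.NumberTheory.Automorphic.UnitaryLatticeTreeEulerRelation                -- ★ the (E1) tree currency; brings ★ `UnitaryLatticeTreeFixedCosetFlags` (`exists_fixedBy_equiv_fixed_selfDual_rankN`, `exists_fixedBy_conj_equiv_fixed_type`, `mk_eq_mk_iff_mapGL_stdLattice_eq`)
import Literature.NumberTheory.Automorphic.UnitaryLatticeTreeFixedFiniteModelTransport     -- ★ `finite_setOf_latticeGraphIso_eq_of_model`, `v_vandermonde_le_of_forall_v_le_one`; brings ★ `exists_unitary_diagonal_coe_eq_diagonal`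
import Literature.NumberTheory.Automorphic.UnitaryLatticeTreeValency                      -- ★ `finite_neighborSet` (the `U(3)` tree is locally finite)
import Literature.NumberTheory.Automorphic.UnitaryLatticeTreeValencyInertPlace            -- ★ `exists_residueField_ringHom_of_v_eq`, `map_mem_integer_of_v_eq`
import Literature.NumberTheory.Rogawski1990.FlickerLiteralEigenframes                    -- ★ `literal_pi_eq_conj_diagonal`, `flickerFramePi_mul_inv`, `flickerFramePiInv_mul`, `diagonal_fin_three`
import Literature.Combinatorics.SimpleGraph.LocallyFiniteBall                            -- ★ `ClosedBall.finite_setOf_dist_le`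
import Literature.Combinatorics.SimpleGraph.TreeDescendantPartition                      -- ★ `TreeLayers.dist_iso_apply`
import HarnessLib

/-!
# R90 · S6 — FIN-2 FILE B: THE FINITENESS LETTERS `hfin₀ hfin₁ horb` OF THE (E1) SHEET FOR FLICKER'S `t_ϖ`-LITERALS
# (`Theorems/R90S6FlickerLiteralFixFinite.lean`)

Cell `hodgecm-mathlib`, crux H413 (`stmt-HodgeConjecture-24833`), route of record `HCCMUnconditional`; programme R90-TF, section S6 (base `R90-C14`); S6 dealer R90-C14-plan (g2)
CARD FIN-2 03:19:38Z; spec = K2Liu-p05 (g9)'s «FIN» census §(G1) (sibling of ★ FIN-1 `R90S6EllipticFixFinite`, the `t_1`-literal); consumers = typ1 (g3)'s (E1) sheet v2.3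
(the appended letters `hfin₀ᵢ hfin₁ᵢ horbᵢ`, `i = 2, 3, 4`) and the G5 ∕ (G1) dischargers (R90-C14-p02 (g3)); helper lane `--supports stmt-HodgeConjecture-24833 --as helper`.

THE MATHEMATICS.  The literal `t_ϖ(a,b,c) ∈ U = U(σ, Φ₃)(K)` (typ1's `γ₂`; `γ₃ = t_ϖ(a,c,b)`, `γ₄ = t_ϖ(b,a,c)` are the same head with letters permuted) is `P · diag(a,b,c) · P⁻¹` for
Flicker's frame `P = D_ϖ h = !![ϖ,0,ϖ;0,1,0;−1,0,1]` (★ `literal_pi_eq_conj_diagonal`), whose Gram matrix is `ᵗσ(P) Φ₃ P = diag(−2ϖ, 1, 2ϖ)` (★ `gram_flickerFrame_pi`) — NOT unimodular,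
but with entries of valuation in `[|ϖ|, 1]`.
* §1 `flickerFin_finite_setOf_latticeGraphIso_eq_pi`: the `t_ϖ`-fixed VERTICES of the lattice graph of `(K³, Φ₃)` form a finite set — ★ model transport `finite_setOf_latticeGraphIso_eq_of_model`
  (`v ↦ P⁻¹·v` carries them injectively to the `diag(a,b,c)`-fixed vertices of the lattice graph of `diag(−2ϖ, 1, 2ϖ)`), finite by ★ FILE A `diagFixedPi_finite_setOf_latticeGraphIso_diagonal_eq`
  (J4a-ϖ) for `a, b, c` of norm one and pairwise DISTINCT (no regime hypothesis).
* §2 the COSET letters: generic bridges `flickerFin_finite_fixedBy_quotient_glInt_of_vertex` ∕ `…_conj_glInt_of_vertex` (a finite fixed-vertex set gives finite `Fix(U ⧸ K₀)` and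
  `Fix(U ⧸ K₁)` through ★ `exists_fixedBy_equiv_fixed_selfDual_rankN` ∕ `exists_fixedBy_conj_equiv_fixed_type`, exactly as ★ FIN-1 §2 and ★ EulerRelation do), then
  **`flickerFin_finite_fixedBy_quotient_glInt_pi`** (`hfin₀`) and **`flickerFin_finite_fixedBy_quotient_conj_glInt_pi`** (`hfin₁`) in the (E1) sheet's bytes.
* §3 **`flickerFin_finite_range_pow_mk_pi`** (`horb`): `t_ϖ` fixes the special vertex `v₁ = (w₀ g₁)·L₀` adjacent to the root (★ FRAMES `flickerFrame_weyl_mem_fixedBy` — in EVERY regime),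
  hence so do its powers, and `dist(v₁, γⁿ·L₀) = dist(γⁿ·v₁, γⁿ·L₀) = dist(v₁, L₀)` (★ `TreeLayers.dist_iso_apply`): the orbit of the root lies in a closed ball of the locally finite
  tree (★ `finite_neighborSet`, ★ `ClosedBall.finite_setOf_dist_le`), and `u·K₀ ↦ u·L₀` is injective (★ `mk_eq_mk_iff_mapGL_stdLattice_eq`).
[Flicker1998UnitaryFL, §2 Prop. 3 pp. 78–79; §3 p. 80] [Kottwitz1986BaseChangeUnits, §1 pp. 240–241] [Rogawski1990, §4.9 Lemma 4.9.3 pp. 55–56] [Serre1980Trees, I.6.1, II.1.1]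
[BruhatTits1972, §10].
HONEST LABEL: finiteness letters = count-neutral plumbing of (E1)∕(E2) over ★ organs; closes no socket.  HC_CM is proved only modulo the 7 printed citations (2 remaining named
inputs: hLiu418 = `stmt-HodgeConjecture-24832`, h413 = `stmt-HodgeConjecture-24833`) until rung 0 closes.

## References
* [Flicker1998UnitaryFL] Y. Z. Flicker, *Elementary proof of the fundamental lemma for a unitary group*, Canad. J. Math. 50 (1998) 74–98: §2 Prop. 3 pp. 78–79 (`t₁…t₄`, frames), §3 p. 80.
* [Kottwitz1986BaseChangeUnits] R. E. Kottwitz, *Base change for unit elements of Hecke algebras*, Compositio Math. 60 (1986) 237–250: §1 pp. 240–241 (orbital integrals as finite fixed-lattice counts).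
* [Rogawski1990] J. D. Rogawski, *Automorphic Representations of Unitary Groups in Three Variables*, Ann. of Math. Stud. 123 (1990): §4.9 Lemma 4.9.3 pp. 55–56.
* [Serre1980Trees] J.-P. Serre, *Trees* (1980): I.6.1 (groups acting on trees, fixed points), II.1.1 (the tree of lattice classes).
* [BruhatTits1972] F. Bruhat, J. Tits, *Groupes réductifs sur un corps local I*, Publ. Math. IHÉS 41 (1972): §10.
-/

set_option autoImplicit false
-- the mandated namespace repeats the single-problem summit's segment (`HodgeConjecture.HodgeConjecture`)
set_option linter.dupNamespace false

noncomputable section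

open Matrix
open scoped MatrixGroups WithZero Valued
open Literature.NumberTheory.Automorphic Literature.NumberTheory.Automorphic.HermitianLattice Literature.NumberTheory.Automorphic.UnitaryGroup
open Literature.NumberTheory.Automorphic.CartanUnique Literature.NumberTheory.Automorphic.UnitaryLatticeTree
open Literature.NumberTheory.Rogawski1990 (diag_mul_flickerFrame_one)
open Literature.NumberTheory.Rogawski1990.Flicker1998 (literal_pi_eq_conj_diagonal flickerFramePi_mul_inv flickerFramePiInv_mul)
open Literature.Combinatorics.SimpleGraph

namespace Summit.HodgeConjecture.HodgeConjecture.R90.S6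

variable {K : Type*} [Field K] [Valued K ℤᵐ⁰] [ValuativeRel K] [(Valued.v : Valuation K ℤᵐ⁰).Compatible] {σ : K →+* K} {ϖ : K}

/-! ## §1 The literal `t_ϖ(a,b,c)` fixes finitely many VERTICES of the lattice graph of `(K³, Φ₃)` -/

omit [ValuativeRel K] [(Valued.v : Valuation K ℤᵐ⁰).Compatible] in
/-- **`Fix(t_ϖ(a,b,c))` is a finite set of vertices**: for `σ` valuation-preserving fixing the uniformiser `ϖ`, finite residue field, `|2| = 1`, `2e = 1` and `a, b, c` of norm one
and pairwise distinct, the vertices of the lattice graph of `(K³, Φ₃)` fixed by the unitary element with matrix `t_ϖ(a,b,c)` form a finite set — ★ model transport at Flicker's frame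
`P = D_ϖ h` (Gram `diag(−2ϖ, 1, 2ϖ)`) followed by ★ FILE A (J4a-ϖ) for the diagonal form with entries of valuation `(|ϖ|, 1, |ϖ|)`. [cite: Flicker1998UnitaryFL, §2 Prop. 3 pp. 78–79]
[cite: Kottwitz1986BaseChangeUnits, §1 pp. 240–241] [cite: Rogawski1990, §4.9 Lemma 4.9.3 pp. 55–56] -/
theorem flickerFin_finite_setOf_latticeGraphIso_eq_pi (hvσ : ∀ x, Valued.v (σ x) = Valued.v x) (hϖ : Valued.v ϖ = WithZero.exp (-1 : ℤ)) (hσϖ : σ ϖ = ϖ)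
    [Fintype 𝓀[K]] (h2 : Valued.v (2 : K) = 1) {e : K} (h2e : 2 * e = 1)
    {a b c : K} (ha : σ a * a = 1) (hb : σ b * b = 1) (hc : σ c * c = 1) (hab : a ≠ b) (hbc : b ≠ c) (hac : a ≠ c)
    (γ : ↥(unitaryGroupOfForm σ ((StdForm.antidiagonal 3).over K)))
    (hγ : ((γ : GL (Fin 3) K) : Matrix (Fin 3) (Fin 3) K) = !![e * (a + c), 0, -(e * (a - c) * ϖ); 0, b, 0; -(e * (a - c) * ϖ⁻¹), 0, e * (a + c)]) :
    {v : {M : Submodule 𝒪[K] (Fin 3 → K) // IsVertex σ ϖ ((StdForm.antidiagonal 3).over K) M} |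
      latticeGraphIso σ ϖ ((StdForm.antidiagonal 3).over K) γ v = v}.Finite := by
  haveI : Finite 𝓀[K] := Finite.of_fintype _
  have hϖ0 : ϖ ≠ 0 := uniformizer_ne_zero hϖ
  have hϖ1 : Valued.v ϖ ≤ 1 := uniformizer_mem_integer hϖ
  have hϖϖ : ϖ * ϖ⁻¹ = 1 := mul_inv_cancel₀ hϖ0
  -- Flicker's frame `P = D_ϖ h` as an element of `GL₃(K)`, with its inverse `h′ D_{ϖ⁻¹}` (★ `flickerFramePi_mul_inv` ∕ `flickerFramePiInv_mul`)
  let P : GL (Fin 3) K :=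
    ⟨!![ϖ, 0, 0; 0, 1, 0; 0, 0, 1] * !![(1 : K), 0, 1; 0, 1, 0; -1, 0, 1], !![e, 0, -e; 0, 1, 0; e, 0, e] * !![ϖ⁻¹, 0, 0; 0, 1, 0; 0, 0, 1],
      flickerFramePi_mul_inv h2e hϖϖ, flickerFramePiInv_mul h2e hϖϖ⟩
  have hP : (P : Matrix (Fin 3) (Fin 3) K) = !![ϖ, 0, 0; 0, 1, 0; 0, 0, 1] * !![(1 : K), 0, 1; 0, 1, 0; -1, 0, 1] := rfl
  have hPinv : ((P⁻¹ : GL (Fin 3) K) : Matrix (Fin 3) (Fin 3) K) = !![e, 0, -e; 0, 1, 0; e, 0, e] * !![ϖ⁻¹, 0, 0; 0, 1, 0; 0, 0, 1] := rfl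
  -- the literal in the eigenframe: `t_ϖ = (D_ϖ h) · diag(a,b,c) · (h′ D_{ϖ⁻¹})`
  have hγP : ((γ : GL (Fin 3) K) : Matrix (Fin 3) (Fin 3) K) =
      (P : Matrix (Fin 3) (Fin 3) K) * Matrix.diagonal ![a, b, c] * ((P⁻¹ : GL (Fin 3) K) : Matrix (Fin 3) (Fin 3) K) := by
    rw [hγ, hP, hPinv, Literature.NumberTheory.Rogawski1990.Flicker1998.diagonal_fin_three, literal_pi_eq_conj_diagonal hϖϖ]
  -- the model form: `ᵗσ(P) Φ₃ P = diag(−2ϖ, 1, 2ϖ)`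
  have hgram : formCongr σ P ((StdForm.antidiagonal 3).over K) = Matrix.diagonal ![-(2 * ϖ), 1, 2 * ϖ] := by
    show ((P : Matrix (Fin 3) (Fin 3) K).map σ)ᵀ * (StdForm.antidiagonal 3).over K * (P : Matrix (Fin 3) (Fin 3) K) = _
    rw [hP, diag_mul_flickerFrame_one, antidiagonal_three_over_eq, Literature.NumberTheory.Rogawski1990.Flicker1998.diagonal_fin_three]
    ext i j
    fin_cases i <;> fin_cases j <;> simp [Matrix.mul_apply, Fin.sum_univ_three, hσϖ] <;> ring
  have hH' : Matrix.diagonal ![-(2 * ϖ), 1, 2 * ϖ] = (1 : K) • formCongr σ P ((StdForm.antidiagonal 3).over K) := by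
    rw [one_smul, hgram]
  -- `T = diag(a,b,c) ∈ U(σ, diag(−2ϖ, 1, 2ϖ))`
  have hsσ : ∀ i, (![a, b, c] : Fin 3 → K) i * σ ((![a, b, c] : Fin 3 → K) i) = 1 := flickerLiteral_normOne_letters σ ha hb hc
  obtain ⟨T, hT⟩ := exists_unitary_diagonal_coe_eq_diagonal (σ := σ) (![-(2 * ϖ), 1, 2 * ϖ]) (![a, b, c]) hsσ
  have hγ' : (γ : GL (Fin 3) K) = P * (T : GL (Fin 3) K) * P⁻¹ := by
    apply Units.ext
    rw [hγP, Units.val_mul, Units.val_mul, hT]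
  -- the data of ★ FILE A
  have hd : ∀ i, Valued.v ϖ ≤ Valued.v ((![-(2 * ϖ), 1, 2 * ϖ] : Fin 3 → K) i) ∧ Valued.v ((![-(2 * ϖ), 1, 2 * ϖ] : Fin 3 → K) i) ≤ 1 := by
    intro i
    fin_cases i <;> simp [h2, hϖ1]
  have ha1 := (flickerLiteral_norm_one_letters σ hvσ ha).2
  have hb1 := (flickerLiteral_norm_one_letters σ hvσ hb).2
  have hc1 := (flickerLiteral_norm_one_letters σ hvσ hc).2
  have hs : ∀ l, Valued.v ((![a, b, c] : Fin 3 → K) l) ≤ 1 := by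
    intro l
    fin_cases l <;> simp [ha1.le, hb1.le, hc1.le]
  have hδ0 : ((![a, b, c] : Fin 3 → K) 0 - (![a, b, c] : Fin 3 → K) 1) * ((![a, b, c] : Fin 3 → K) 0 - (![a, b, c] : Fin 3 → K) 2) *
      ((![a, b, c] : Fin 3 → K) 1 - (![a, b, c] : Fin 3 → K) 2) ≠ 0 :=
    mul_ne_zero (mul_ne_zero (sub_ne_zero.2 hab) (sub_ne_zero.2 hac)) (sub_ne_zero.2 hbc)
  exact finite_setOf_latticeGraphIso_eq_of_model σ ϖ (c := (1 : K)) (map_one _) _ P hH' γ T hγ'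
    (diagFixedPi_finite_setOf_latticeGraphIso_diagonal_eq hvσ hϖ hd hs hδ0 (v_vandermonde_le_of_forall_v_le_one hs) T hT)

/-! ## §2 The COSET letters: a finite fixed-vertex set gives finite `Fix(U ⧸ K₀)` and `Fix(U ⧸ K₁)` -/

/-- **COSETS FROM VERTICES, `K₀`**: for the unramified datum, if `γ ∈ U` fixes finitely many vertices of the lattice graph then `Fix_γ(U ⧸ K₀)` is finite (`K₀ = GL₃(𝒪) ∩ U`) —
`Fix(U ⧸ K₀)` is in bijection with the `γ`-fixed SELF-DUAL vertices (★ `exists_fixedBy_equiv_fixed_selfDual_rankN`; the root is self-dual and `U` is transitive on self-dual lattices).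
[cite: Kottwitz1986BaseChangeUnits, §1 pp. 240–241] [cite: Serre1980Trees, I.6.1] -/
theorem flickerFin_finite_fixedBy_quotient_glInt_of_vertex (hd : UnramifiedLocalConjDatum σ ϖ)
    (γ : ↥(unitaryGroupOfForm σ ((StdForm.antidiagonal 3).over K)))
    (hfinV : {v : {M : Submodule 𝒪[K] (Fin 3 → K) // IsVertex σ ϖ ((StdForm.antidiagonal 3).over K) M} |
      latticeGraphIso σ ϖ ((StdForm.antidiagonal 3).over K) γ v = v}.Finite) :
    (MulAction.fixedBy (↥(unitaryGroupOfForm σ ((StdForm.antidiagonal 3).over K)) ⧸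
      (glInt 3 K).subgroupOf (unitaryGroupOfForm σ ((StdForm.antidiagonal 3).over K))) γ).Finite := by
  have hroot : IsSelfDualLattice σ ϖ ((StdForm.antidiagonal 3).over K) (stdLattice K 3) := isSelfDualLattice_stdLattice_three hd
  have hA : ∀ M : Submodule (Valued.integer K) (Fin 3 → K), IsSelfDualLattice σ ϖ ((StdForm.antidiagonal 3).over K) M →
      ∃ u : ↥(unitaryGroupOfForm σ ((StdForm.antidiagonal 3).over K)), mapGL (u : GL (Fin 3) K) (stdLattice K 3) = M := fun M hM =>
    exists_unitary_mapGL_stdLattice_eq_of_isSelfDualLattice_of_trace hd.σσ hd.vσ hd.vϖ hd.trace hM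
  obtain ⟨eA, -⟩ := exists_fixedBy_equiv_fixed_selfDual_rankN σ ϖ _ hroot hA γ
  haveI : Finite ↥{v : {M : Submodule (Valued.integer K) (Fin 3 → K) // IsVertex σ ϖ ((StdForm.antidiagonal 3).over K) M} |
      latticeGraphIso σ ϖ ((StdForm.antidiagonal 3).over K) γ v = v ∧ IsSelfDualLattice σ ϖ ((StdForm.antidiagonal 3).over K) v.1} :=
    (hfinV.subset fun v hv => hv.1).to_subtype
  haveI := Finite.of_equiv _ eA.symm
  exact Set.toFinite _

/-- **COSETS FROM VERTICES, `K₁`**: likewise `Fix_γ(U ⧸ K₁)` is finite (`K₁ = g₁ GL₃(𝒪) g₁⁻¹ ∩ U`, `g₁ = diag(1,1,ϖ)`, the stabiliser of the type-`2` vertex `N₁ = g₁·L₀`) — ★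
`exists_fixedBy_conj_equiv_fixed_type`, `U` transitive on type-`2` lattices (★ `forall_isVertexLattice_two_exists_mapGL_N₁_eq`). [cite: Kottwitz1986BaseChangeUnits, §1 pp. 240–241]
[cite: Serre1980Trees, I.6.1] -/
theorem flickerFin_finite_fixedBy_quotient_conj_glInt_of_vertex (hd : UnramifiedLocalConjDatum σ ϖ)
    (g₁ : GL (Fin 3) K) (hg₁ : (g₁ : Matrix (Fin 3) (Fin 3) K) = Matrix.diagonal ![(1 : K), 1, ϖ])
    (γ : ↥(unitaryGroupOfForm σ ((StdForm.antidiagonal 3).over K)))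
    (hfinV : {v : {M : Submodule 𝒪[K] (Fin 3 → K) // IsVertex σ ϖ ((StdForm.antidiagonal 3).over K) M} |
      latticeGraphIso σ ϖ ((StdForm.antidiagonal 3).over K) γ v = v}.Finite) :
    (MulAction.fixedBy (↥(unitaryGroupOfForm σ ((StdForm.antidiagonal 3).over K)) ⧸
      ((glInt 3 K).map (MulAut.conj g₁).toMonoidHom).subgroupOf (unitaryGroupOfForm σ ((StdForm.antidiagonal 3).over K))) γ).Finite := by
  have hϖ0 : ϖ ≠ 0 := uniformizer_ne_zero hd.vϖ
  have hϖ1 : Valued.v ϖ ≤ 1 := uniformizer_mem_integer hd.vϖ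
  have hN₁ : mapGL g₁ (stdLattice K 3) = latt (Matrix.diagonal ![(1 : K), 1, ϖ]) := by rw [← hg₁]; rfl
  have hg₁2 : IsVertexLattice σ ϖ ((StdForm.antidiagonal 3).over K) 2 (mapGL g₁ (stdLattice K 3)) := by
    rw [hN₁]; exact isVertexLattice_two_latt_diagonal_one_one hd.σϖ hϖ1 hϖ0
  have hB : ∀ M : Submodule (Valued.integer K) (Fin 3 → K), IsVertexLattice σ ϖ ((StdForm.antidiagonal 3).over K) 2 M →
      ∃ u : ↥(unitaryGroupOfForm σ ((StdForm.antidiagonal 3).over K)), mapGL ((u : GL (Fin 3) K) * g₁) (stdLattice K 3) = M := by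
    intro M hM
    obtain ⟨u, hu⟩ := forall_isVertexLattice_two_exists_mapGL_N₁_eq hd M hM
    exact ⟨u, by rw [mapGL_mul, hN₁, hu]⟩
  obtain ⟨eB, -⟩ := exists_fixedBy_conj_equiv_fixed_type σ ϖ _ hg₁2 hB γ
  haveI : Finite ↥{v : {M : Submodule (Valued.integer K) (Fin 3 → K) // IsVertex σ ϖ ((StdForm.antidiagonal 3).over K) M} |
      latticeGraphIso σ ϖ ((StdForm.antidiagonal 3).over K) γ v = v ∧ IsVertexLattice σ ϖ ((StdForm.antidiagonal 3).over K) 2 v.1} :=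
    (hfinV.subset fun v hv => hv.1).to_subtype
  haveI := Finite.of_equiv _ eB.symm
  exact Set.toFinite _

/-- **`hfin₀` for `t_ϖ(a,b,c)` — `Fix_{t_ϖ}(U ⧸ K₀)` IS FINITE** (the (E1) sheet's letter `hfin₀₂`; `hfin₀₃`, `hfin₀₄` by permuting `a, b, c`). [cite: Flicker1998UnitaryFL, §2 Prop. 3 pp. 78–79; §3 p. 80]
[cite: Kottwitz1986BaseChangeUnits, §1 pp. 240–241] -/
theorem flickerFin_finite_fixedBy_quotient_glInt_pi (hd : UnramifiedLocalConjDatum σ ϖ) [Fintype 𝓀[K]]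
    (h2 : Valued.v (2 : K) = 1) {e : K} (h2e : 2 * e = 1)
    {a b c : K} (ha : σ a * a = 1) (hb : σ b * b = 1) (hc : σ c * c = 1) (hab : a ≠ b) (hbc : b ≠ c) (hac : a ≠ c)
    (γ : ↥(unitaryGroupOfForm σ ((StdForm.antidiagonal 3).over K)))
    (hγ : ((γ : GL (Fin 3) K) : Matrix (Fin 3) (Fin 3) K) = !![e * (a + c), 0, -(e * (a - c) * ϖ); 0, b, 0; -(e * (a - c) * ϖ⁻¹), 0, e * (a + c)]) :
    (MulAction.fixedBy (↥(unitaryGroupOfForm σ ((StdForm.antidiagonal 3).over K)) ⧸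
      (glInt 3 K).subgroupOf (unitaryGroupOfForm σ ((StdForm.antidiagonal 3).over K))) γ).Finite :=
  flickerFin_finite_fixedBy_quotient_glInt_of_vertex hd γ
    (flickerFin_finite_setOf_latticeGraphIso_eq_pi hd.vσ hd.vϖ hd.σϖ h2 h2e ha hb hc hab hbc hac γ hγ)

/-- **`hfin₁` for `t_ϖ(a,b,c)` — `Fix_{t_ϖ}(U ⧸ K₁)` IS FINITE** (the (E1) sheet's letter `hfin₁₂`; `hfin₁₃`, `hfin₁₄` by permuting `a, b, c`). [cite: Flicker1998UnitaryFL, §2 Prop. 3 pp. 78–79; §3 p. 80]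
[cite: Kottwitz1986BaseChangeUnits, §1 pp. 240–241] -/
theorem flickerFin_finite_fixedBy_quotient_conj_glInt_pi (hd : UnramifiedLocalConjDatum σ ϖ) [Fintype 𝓀[K]]
    (h2 : Valued.v (2 : K) = 1) {e : K} (h2e : 2 * e = 1)
    {a b c : K} (ha : σ a * a = 1) (hb : σ b * b = 1) (hc : σ c * c = 1) (hab : a ≠ b) (hbc : b ≠ c) (hac : a ≠ c)
    (g₁ : GL (Fin 3) K) (hg₁ : (g₁ : Matrix (Fin 3) (Fin 3) K) = Matrix.diagonal ![(1 : K), 1, ϖ])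
    (γ : ↥(unitaryGroupOfForm σ ((StdForm.antidiagonal 3).over K)))
    (hγ : ((γ : GL (Fin 3) K) : Matrix (Fin 3) (Fin 3) K) = !![e * (a + c), 0, -(e * (a - c) * ϖ); 0, b, 0; -(e * (a - c) * ϖ⁻¹), 0, e * (a + c)]) :
    (MulAction.fixedBy (↥(unitaryGroupOfForm σ ((StdForm.antidiagonal 3).over K)) ⧸
      ((glInt 3 K).map (MulAut.conj g₁).toMonoidHom).subgroupOf (unitaryGroupOfForm σ ((StdForm.antidiagonal 3).over K))) γ).Finite :=
  flickerFin_finite_fixedBy_quotient_conj_glInt_of_vertex hd g₁ hg₁ γ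
    (flickerFin_finite_setOf_latticeGraphIso_eq_pi hd.vσ hd.vϖ hd.σϖ h2 h2e ha hb hc hab hbc hac γ hγ)

/-! ## §3 The ORBIT letter `horb`: the powers of `t_ϖ` move the root coset within a finite set -/

/-- **`horb` for `t_ϖ(a,b,c)` — THE `⟨t_ϖ⟩`-ORBIT OF THE ROOT COSET IS FINITE** (the (E1) sheet's letter `horb₂`; `horb₃`, `horb₄` by permuting `a, b, c`): `t_ϖ` fixes the special
vertex `v₁ = (w₀ g₁)·L₀` (★ FRAMES `flickerFrame_weyl_mem_fixedBy`, valid in every regime), hence so does `t_ϖⁿ`; so `dist(v₁, t_ϖⁿ·L₀) = dist(v₁, L₀)` (★ `TreeLayers.dist_iso_apply`) and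
the orbit of the root vertex lies in a closed ball of the locally finite lattice tree (★ `finite_neighborSet`, ★ `ClosedBall.finite_setOf_dist_le`); `u·K₀ ↦ u·L₀` is injective
(★ `mk_eq_mk_iff_mapGL_stdLattice_eq`).  No regime and no distinctness hypothesis is needed. [cite: Serre1980Trees, I.6.1, II.1.1] [cite: BruhatTits1972, §10]
[cite: Flicker1998UnitaryFL, §2 Prop. 3 p. 79] -/
theorem flickerFin_finite_range_pow_mk_pi (hd : UnramifiedLocalConjDatum σ ϖ) [Fintype 𝓀[K]]
    (h2 : Valued.v (2 : K) = 1) {e : K} (h2e : 2 * e = 1) {a b c : K} (ha : σ a * a = 1) (hb : σ b * b = 1) (hc : σ c * c = 1)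
    (γ : ↥(unitaryGroupOfForm σ ((StdForm.antidiagonal 3).over K)))
    (hγ : ((γ : GL (Fin 3) K) : Matrix (Fin 3) (Fin 3) K) = !![e * (a + c), 0, -(e * (a - c) * ϖ); 0, b, 0; -(e * (a - c) * ϖ⁻¹), 0, e * (a + c)]) :
    (Set.range fun n : ℕ => ((γ ^ n : ↥(unitaryGroupOfForm σ ((StdForm.antidiagonal 3).over K))) :
      ↥(unitaryGroupOfForm σ ((StdForm.antidiagonal 3).over K)) ⧸ (glInt 3 K).subgroupOf (unitaryGroupOfForm σ ((StdForm.antidiagonal 3).over K)))).Finite := by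
  classical
  haveI : Finite 𝓀[K] := Finite.of_fintype _
  have hϖ0 : ϖ ≠ 0 := uniformizer_ne_zero hd.vϖ
  have hϖ1 : Valued.v ϖ ≤ 1 := uniformizer_mem_integer hd.vϖ
  -- `g₁ = diag(1,1,ϖ)` and `w₀ = antidiag(1,1,1)`
  let g₁ : GL (Fin 3) K := Matrix.GeneralLinearGroup.mkOfDetNeZero (Matrix.diagonal ![(1 : K), 1, ϖ])
    (by rw [Matrix.det_diagonal, Fin.prod_univ_three]; simp [hϖ0])
  have hg₁ : (g₁ : Matrix (Fin 3) (Fin 3) K) = Matrix.diagonal ![(1 : K), 1, ϖ] := rfl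
  let w : ↥(unitaryGroupOfForm σ ((StdForm.antidiagonal 3).over K)) := weylLongU σ rfl
  have hw : ((w : GL (Fin 3) K) : Matrix (Fin 3) (Fin 3) K) = !![(0 : K), 0, 1; 0, 1, 0; 1, 0, 0] := coe_coe_weylLongU_three σ rfl
  -- every power of `γ` fixes the special coset `w·K₁`
  have hconj : ∀ n : ℕ, w⁻¹ * γ ^ n * w = (w⁻¹ * γ * w) ^ n := by
    intro n
    induction n with
    | zero => simp
    | succ n ih => rw [pow_succ, pow_succ, ← ih]; group
  have hfixn : ∀ n : ℕ, ((w : ↥(unitaryGroupOfForm σ ((StdForm.antidiagonal 3).over K))) :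
      ↥(unitaryGroupOfForm σ ((StdForm.antidiagonal 3).over K)) ⧸
        ((glInt 3 K).map (MulAut.conj g₁).toMonoidHom).subgroupOf (unitaryGroupOfForm σ ((StdForm.antidiagonal 3).over K))) ∈
      MulAction.fixedBy _ (γ ^ n) := by
    intro n
    have h1 := flickerFrame_weyl_mem_fixedBy hd.vσ h2 h2e hϖ0 ha hb hc g₁ hg₁ w hw γ hγ
    rw [mem_fixedBy_quotient_mk_iff] at h1 ⊢
    rw [hconj n]
    exact Subgroup.pow_mem _ h1 n
  -- the special vertex `v₁ = (w g₁)·L₀`, fixed by every `γⁿ`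
  have hN₁ : mapGL g₁ (stdLattice K 3) = latt (Matrix.diagonal ![(1 : K), 1, ϖ]) := by rw [← hg₁]; rfl
  have hg₁2 : IsVertexLattice σ ϖ ((StdForm.antidiagonal 3).over K) 2 (mapGL g₁ (stdLattice K 3)) := by
    rw [hN₁]; exact isVertexLattice_two_latt_diagonal_one_one hd.σϖ hϖ1 hϖ0
  have hB : ∀ M : Submodule (Valued.integer K) (Fin 3 → K), IsVertexLattice σ ϖ ((StdForm.antidiagonal 3).over K) 2 M →
      ∃ u : ↥(unitaryGroupOfForm σ ((StdForm.antidiagonal 3).over K)), mapGL ((u : GL (Fin 3) K) * g₁) (stdLattice K 3) = M := by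
    intro M hM
    obtain ⟨u, hu⟩ := forall_isVertexLattice_two_exists_mapGL_N₁_eq hd M hM
    exact ⟨u, by rw [mapGL_mul, hN₁, hu]⟩
  have hv₁t : IsVertexLattice σ ϖ ((StdForm.antidiagonal 3).over K) 2 (mapGL ((w : GL (Fin 3) K) * g₁) (stdLattice K 3)) := by
    rw [mapGL_mul]; exact isVertexLattice_mapGL σ ϖ _ _ w.2 hg₁2
  let v₁ : {M : Submodule 𝒪[K] (Fin 3 → K) // IsVertex σ ϖ ((StdForm.antidiagonal 3).over K) M} :=
    ⟨mapGL ((w : GL (Fin 3) K) * g₁) (stdLattice K 3), ⟨2, hv₁t⟩⟩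
  have hfixv : ∀ n : ℕ, latticeGraphIso σ ϖ ((StdForm.antidiagonal 3).over K) (γ ^ n) v₁ = v₁ := by
    intro n
    obtain ⟨eB, heB⟩ := exists_fixedBy_conj_equiv_fixed_type σ ϖ _ hg₁2 hB (γ ^ n)
    have hx := (eB ⟨_, hfixn n⟩).2.1
    have hx1 : ((eB ⟨_, hfixn n⟩) : {M : Submodule 𝒪[K] (Fin 3 → K) // IsVertex σ ϖ ((StdForm.antidiagonal 3).over K) M}) = v₁ :=
      Subtype.ext (heB w (hfixn n))
    rw [hx1] at hx
    exact hx
  -- the root vertex and the locally finite, connected tree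
  have hroot : IsSelfDualLattice σ ϖ ((StdForm.antidiagonal 3).over K) (stdLattice K 3) := isSelfDualLattice_stdLattice_three hd
  let r₀ : {M : Submodule 𝒪[K] (Fin 3 → K) // IsVertex σ ϖ ((StdForm.antidiagonal 3).over K) M} := ⟨stdLattice K 3, ⟨0, hroot⟩⟩
  obtain ⟨σk, hσk⟩ := exists_residueField_ringHom_of_v_eq hd.vσ
  have hloc : ∀ v, ((latticeGraph σ ϖ ((StdForm.antidiagonal 3).over K)).neighborSet v).Finite := fun v =>
    finite_neighborSet hd (map_mem_integer_of_v_eq hd.vσ) σk hσk v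
  have hconn : (latticeGraph σ ϖ ((StdForm.antidiagonal 3).over K)).Connected := (isTree_latticeGraph_three_of_unramified hd).connected
  have hball : {x | (latticeGraph σ ϖ ((StdForm.antidiagonal 3).over K)).dist v₁ x ≤ (latticeGraph σ ϖ ((StdForm.antidiagonal 3).over K)).dist v₁ r₀}.Finite :=
    ClosedBall.finite_setOf_dist_le hloc hconn v₁ _
  -- `dist(v₁, γⁿ·r₀) = dist(v₁, r₀)`
  have hdist : ∀ n : ℕ, (latticeGraph σ ϖ ((StdForm.antidiagonal 3).over K)).dist v₁ (latticeGraphIso σ ϖ ((StdForm.antidiagonal 3).over K) (γ ^ n) r₀) =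
      (latticeGraph σ ϖ ((StdForm.antidiagonal 3).over K)).dist v₁ r₀ := by
    intro n
    conv_lhs => rw [← hfixv n]
    exact TreeLayers.dist_iso_apply _ _ _
  -- the coset → vertex dictionary `u·K₀ ↦ u·L₀` (injective)
  let vA : ↥(unitaryGroupOfForm σ ((StdForm.antidiagonal 3).over K)) → {M : Submodule (Valued.integer K) (Fin 3 → K) // IsVertex σ ϖ ((StdForm.antidiagonal 3).over K) M} :=
    fun u => ⟨mapGL (u : GL (Fin 3) K) (stdLattice K 3), ⟨0, isVertexLattice_mapGL σ ϖ _ _ u.2 hroot⟩⟩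
  let f : ↥(unitaryGroupOfForm σ ((StdForm.antidiagonal 3).over K)) ⧸ (glInt 3 K).subgroupOf (unitaryGroupOfForm σ ((StdForm.antidiagonal 3).over K)) →
      {M : Submodule (Valued.integer K) (Fin 3 → K) // IsVertex σ ϖ ((StdForm.antidiagonal 3).over K) M} := fun x =>
    Quotient.liftOn' x vA (by
      intro a' b' hab'
      apply Subtype.ext
      change mapGL _ _ = mapGL _ _
      rw [← mk_eq_mk_iff_mapGL_stdLattice_eq σ ((StdForm.antidiagonal 3).over K) a' b']
      exact Quotient.sound' hab')
  have hf : ∀ u : ↥(unitaryGroupOfForm σ ((StdForm.antidiagonal 3).over K)),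
      f (u : ↥(unitaryGroupOfForm σ ((StdForm.antidiagonal 3).over K)) ⧸ (glInt 3 K).subgroupOf (unitaryGroupOfForm σ ((StdForm.antidiagonal 3).over K))) = vA u := fun u => rfl
  have hinj : Function.Injective f := by
    intro x y hxy
    induction x using QuotientGroup.induction_on with
    | H u =>
      induction y using QuotientGroup.induction_on with
      | H u' =>
        rw [hf, hf] at hxy
        exact (mk_eq_mk_iff_mapGL_stdLattice_eq σ ((StdForm.antidiagonal 3).over K) u u').2 (congrArg Subtype.val hxy)
  have hfγ : ∀ n : ℕ, f ((γ ^ n : ↥(unitaryGroupOfForm σ ((StdForm.antidiagonal 3).over K))) :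
      ↥(unitaryGroupOfForm σ ((StdForm.antidiagonal 3).over K)) ⧸ (glInt 3 K).subgroupOf (unitaryGroupOfForm σ ((StdForm.antidiagonal 3).over K))) =
      latticeGraphIso σ ϖ ((StdForm.antidiagonal 3).over K) (γ ^ n) r₀ := by
    intro n
    rw [hf]
    apply Subtype.ext
    rw [latticeGraphIso_apply_coe]
    rfl
  refine Set.Finite.of_finite_image (hball.subset ?_) hinj.injOn
  rintro _ ⟨_, ⟨n, rfl⟩, rfl⟩
  show f _ ∈ {x | (latticeGraph σ ϖ ((StdForm.antidiagonal 3).over K)).dist v₁ x ≤ (latticeGraph σ ϖ ((StdForm.antidiagonal 3).over K)).dist v₁ r₀}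
  rw [Set.mem_setOf_eq, hfγ n, hdist n]

end Summit.HodgeConjecture.HodgeConjecture.R90.S6

end
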